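import Summits.CriticalPhenomena.PercolationContinuityZ3.Theorems.SahiMasterFamilyPrincipalCapBetaSmall

/-!
# A checkable certificate format for the principal-cap inequalities `F(n)` (`PhiNonneg n`), part 1: sparse polynomials

Unit `prim-masterthm-p4` (gen 13; crux anchor stmt-CriticalPhenomena-4575, helper work; memo
`run/shared/lean/prim/prim-masterthm/prim-masterthm-p4/P4-GEN13-REPORT.md` §7, §9).

The certificates for `F(6)` (kit j122110) and `F(7)` (kit j124604) found by symmetry-reduced column generation have the shape
  `Φ_n(β) = (1/n!) Σ_{g ∈ S_n} Σ_t c_t · g·(∏ atoms_t)`,  atoms `b_S = β_S`, `d_S = 1 − β_S`, `h(S;A,B) = β_S − β_A β_B` (`A ∪ B = S`),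
with 15 resp. 50 orbit terms but 872 resp. 22 050 distinct products after symmetrisation — too many for the chunked `ring` pipeline of
`…PrincipalCapBetaSix*`.  This file is a small VERIFIED polynomial-identity checker (proof by reflection): a syntax of sparse polynomials in
the variables `β_S` (`S` a bitmask), their evaluation `evalP`, sound operations (`++`, `mulP`, `scaleP`, fuelled merge sort + combine =
`normP`), a SYMBOLIC Lieb–Sahi recursion `symE` computing Sahi's `E_n` of a family of products of coordinate indicators in the canonical
signed model (`symE_sound`, mirroring `sahiE_succ_succ`), the certificate expander (`orbit images under all permutations`, `termsPoly`) with
its soundness (`evalP_termsPoly`, `termsPoly_nonneg`), and the final transfer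
`phiNonneg_of_verify : verify n M C = true → PhiNonneg n` — so that each new certificate becomes ONE `decide`.
This file (part 1): the polynomial syntax `Mono`/`Poly`, evaluation `evalP`, and the SOUND operations `++`, `mulP`, `scaleP`, `normP` (fuelled merge sort
+ combination of equal monomials).  Part 2 (`…PhiCert`): variables, `symE`, atoms, orbit expansion, `verify`, `phiNonneg_of_verify`.
Nothing here is specific to `n = 7`.  HONEST FRAMING: infrastructure; the mathematical content is in the certificates.  Axioms standard. [this work]
-/

set_option autoImplicit false

namespace Summit.CriticalPhenomena.PercolationContinuityZ3.Theorems

namespace PhiCert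

open Finset Literature.Combinatorics.Sahi2008

/-! ## Sparse polynomials in the variables `β_S` and their evaluation -/

/-- A monomial: a (sorted) list of variable indices (bitmasks of subsets); `[]` is the constant `1`. [this work] -/
abbrev Mono := List ℕ

/-- A sparse polynomial with integer coefficients. [this work] -/
abbrev Poly := List (Mono × ℤ)

/-- Evaluation of a monomial at `v : ℕ → ℝ`. [this work] -/
def evalM (v : ℕ → ℝ) : Mono → ℝ
  | [] => 1
  | a :: m => v a * evalM v m

/-- Evaluation of a polynomial. [this work] -/
def evalP (v : ℕ → ℝ) : Poly → ℝ
  | [] => 0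
  | x :: p => (x.2 : ℝ) * evalM v x.1 + evalP v p

section Eval

variable (v : ℕ → ℝ)

/-- `evalP` as a list sum. [this work] -/
theorem evalP_eq_sum (p : Poly) : evalP v p = (p.map fun x => (x.2 : ℝ) * evalM v x.1).sum := by
  induction p with
  | nil => rfl
  | cons x p ih => rw [evalP, ih, List.map_cons, List.sum_cons]

/-- Evaluation is additive under concatenation. [this work] -/
theorem evalP_append (p q : Poly) : evalP v (p ++ q) = evalP v p + evalP v q := by
  rw [evalP_eq_sum, evalP_eq_sum, evalP_eq_sum, List.map_append, List.sum_append]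

/-- Evaluation of a concatenated monomial. [this work] -/
theorem evalM_append (m₁ m₂ : Mono) : evalM v (m₁ ++ m₂) = evalM v m₁ * evalM v m₂ := by
  induction m₁ with
  | nil => rw [List.nil_append, evalM, one_mul]
  | cons a m ih => rw [List.cons_append, evalM, evalM, ih, mul_assoc]

/-- Fuelled merge of two monomials (sorted variable lists). [this work] -/
def mergeM : ℕ → Mono → Mono → Mono
  | 0, m₁, m₂ => m₁ ++ m₂
  | _ + 1, [], m₂ => m₂
  | _ + 1, a :: m₁, [] => a :: m₁
  | f + 1, a :: m₁, b :: m₂ => if Nat.ble a b then a :: mergeM f m₁ (b :: m₂) else b :: mergeM f (a :: m₁) m₂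

/-- Merging multiplies. [this work] -/
theorem evalM_mergeM : ∀ (f : ℕ) (m₁ m₂ : Mono), evalM v (mergeM f m₁ m₂) = evalM v m₁ * evalM v m₂
  | 0, m₁, m₂ => by rw [mergeM, evalM_append]
  | f + 1, [], m₂ => by rw [mergeM, evalM, one_mul]
  | f + 1, a :: m₁, [] => by rw [mergeM, evalM, evalM, mul_one]
  | f + 1, a :: m₁, b :: m₂ => by
    rw [mergeM]
    split_ifs
    · rw [evalM, evalM_mergeM f m₁ (b :: m₂), evalM, evalM, mul_assoc]
    · rw [evalM, evalM_mergeM f (a :: m₁) m₂, evalM, evalM]; ring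

/-- Product of monomials. [this work] -/
def mulMono (m₁ m₂ : Mono) : Mono := mergeM (m₁.length + m₂.length) m₁ m₂

/-- `mulMono` multiplies. [this work] -/
theorem evalM_mulMono (m₁ m₂ : Mono) : evalM v (mulMono m₁ m₂) = evalM v m₁ * evalM v m₂ :=
  evalM_mergeM v _ _ _

/-- Scaling. [this work] -/
def scaleP (c : ℤ) (p : Poly) : Poly := p.map fun y => (y.1, c * y.2)

/-- Scaling scales. [this work] -/
theorem evalP_scaleP (c : ℤ) (p : Poly) : evalP v (scaleP c p) = (c : ℝ) * evalP v p := by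
  induction p with
  | nil => rw [scaleP, List.map_nil, evalP, mul_zero]
  | cons x p ih =>
    rw [scaleP, List.map_cons, evalP, evalP]
    rw [scaleP] at ih
    rw [ih]; push_cast; ring

/-- Product of a monomial-with-coefficient with a polynomial. [this work] -/
def mulTerm (x : Mono × ℤ) (q : Poly) : Poly := q.map fun y => (mulMono x.1 y.1, x.2 * y.2)

/-- `mulTerm` multiplies. [this work] -/
theorem evalP_mulTerm (x : Mono × ℤ) (q : Poly) : evalP v (mulTerm x q) = ((x.2 : ℝ) * evalM v x.1) * evalP v q := by
  induction q with
  | nil => rw [mulTerm, List.map_nil, evalP, mul_zero]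
  | cons y q ih =>
    rw [mulTerm, List.map_cons, evalP, evalP]
    rw [mulTerm] at ih
    rw [ih, evalM_mulMono]; push_cast; ring

/-- Product of polynomials. [this work] -/
def mulP : Poly → Poly → Poly
  | [], _ => []
  | x :: p, q => mulTerm x q ++ mulP p q

/-- `mulP` multiplies. [this work] -/
theorem evalP_mulP : ∀ (p q : Poly), evalP v (mulP p q) = evalP v p * evalP v q
  | [], q => by rw [mulP, evalP, zero_mul]
  | x :: p, q => by rw [mulP, evalP_append, evalP_mulTerm, evalP_mulP p q, evalP]; ring

/-! ## Normal form: fuelled merge sort by a comparator, then combination of adjacent equal monomials -/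

/-- Fuelled merge of two lists along a comparator. [this work] -/
def mergeBy {α : Type} (le : α → α → Bool) : ℕ → List α → List α → List α
  | 0, l₁, l₂ => l₁ ++ l₂
  | _ + 1, [], l₂ => l₂
  | _ + 1, a :: l₁, [] => a :: l₁
  | f + 1, a :: l₁, b :: l₂ => if le a b then a :: mergeBy le f l₁ (b :: l₂) else b :: mergeBy le f (a :: l₁) l₂

/-- Merging preserves additive valuations. [this work] -/
theorem sum_mergeBy {α : Type} (le : α → α → Bool) (g : α → ℝ) :
    ∀ (f : ℕ) (l₁ l₂ : List α), ((mergeBy le f l₁ l₂).map g).sum = (l₁.map g).sum + (l₂.map g).sum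
  | 0, l₁, l₂ => by rw [mergeBy, List.map_append, List.sum_append]
  | f + 1, [], l₂ => by rw [mergeBy, List.map_nil, List.sum_nil, zero_add]
  | f + 1, a :: l₁, [] => by rw [mergeBy, List.map_nil, List.sum_nil, add_zero]
  | f + 1, a :: l₁, b :: l₂ => by
    rw [mergeBy]
    split_ifs
    · simp only [List.map_cons, List.sum_cons, sum_mergeBy le g f l₁ (b :: l₂)]; ring
    · simp only [List.map_cons, List.sum_cons, sum_mergeBy le g f (a :: l₁) l₂]; ring

/-- Fuelled merge sort along a comparator. [this work] -/
def msortBy {α : Type} (le : α → α → Bool) : ℕ → List α → List α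
  | 0, l => l
  | f + 1, l => if l.length ≤ 1 then l else
      mergeBy le l.length (msortBy le f (l.take (l.length / 2))) (msortBy le f (l.drop (l.length / 2)))

/-- Sorting preserves additive valuations. [this work] -/
theorem sum_msortBy {α : Type} (le : α → α → Bool) (g : α → ℝ) :
    ∀ (f : ℕ) (l : List α), ((msortBy le f l).map g).sum = (l.map g).sum
  | 0, l => by rw [msortBy]
  | f + 1, l => by
    rw [msortBy]
    split_ifs
    · rfl
    · rw [sum_mergeBy, sum_msortBy le g f, sum_msortBy le g f, ← List.sum_append, ← List.map_append,
        List.take_append_drop]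

/-- Lexicographic comparison of monomials. [this work] -/
def monoLE : Mono → Mono → Bool
  | [], _ => true
  | _ :: _, [] => false
  | a :: m₁, b :: m₂ => if a = b then monoLE m₁ m₂ else Nat.blt a b

/-- Combine adjacent entries with equal monomials, dropping zero coefficients. [this work] -/
def combine : Poly → Poly
  | [] => []
  | (m, c) :: p =>
    match combine p with
    | [] => if c = 0 then [] else [(m, c)]
    | (m', c') :: q =>
      if m = m' then (if c + c' = 0 then q else (m, c + c') :: q)
      else (if c = 0 then (m', c') :: q else (m, c) :: (m', c') :: q)

/-- `combine` preserves evaluation. [this work] -/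
theorem evalP_combine : ∀ p : Poly, evalP v (combine p) = evalP v p
  | [] => rfl
  | (m, c) :: p => by
    have ih := evalP_combine p
    have e0 : evalP v ((m, c) :: p) = (c : ℝ) * evalM v m + evalP v p := rfl
    rw [e0, ← ih, combine]
    cases hq : combine p with
    | nil =>
      simp only
      split_ifs with hc
      · rw [evalP, hc]; push_cast; ring
      · rfl
    | cons y q =>
      obtain ⟨m', c'⟩ := y
      simp only
      split_ifs with hm hcc hc
      · subst hm
        have h2 : (c : ℝ) + c' = 0 := by exact_mod_cast hcc
        have e1 : evalP v ((m, c') :: q) = (c' : ℝ) * evalM v m + evalP v q := rfl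
        rw [e1]
        linear_combination (-(evalM v m)) * h2
      · subst hm
        have e1 : evalP v ((m, c') :: q) = (c' : ℝ) * evalM v m + evalP v q := rfl
        have e2 : evalP v ((m, c + c') :: q) = ((c + c' : ℤ) : ℝ) * evalM v m + evalP v q := rfl
        rw [e1, e2]; push_cast; ring
      · rw [hc]; push_cast; ring
      · rfl

/-- The normal form used for the syntactic comparison. [this work] -/
def normP (p : Poly) : Poly := combine (msortBy (fun x y => monoLE x.1 y.1) p.length p)

/-- `normP` preserves evaluation. [this work] -/
theorem evalP_normP (p : Poly) : evalP v (normP p) = evalP v p := by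
  rw [normP, evalP_combine, evalP_eq_sum, sum_msortBy, ← evalP_eq_sum]

end Eval

end PhiCert

end Summit.CriticalPhenomena.PercolationContinuityZ3.Theorems
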